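import Literature.NumberTheory.Automorphic.ResGLnHermitianCone
import Mathlib.Analysis.Matrix.Hermitian
import Mathlib.Analysis.Matrix.PosDef
import Mathlib.Analysis.Normed.Module.RCLike.Basic
import Mathlib.Topology.Instances.Matrix
import Mathlib.Topology.MetricSpace.ProperSpace
import HarnessLib

/-!
# The positive cone of `Res_{K/ℚ} GL_n` is open in the hermitian space

Topic `NumberTheory/Automorphic`; namespace `Literature.NumberTheory.Automorphic.ResGLnCone`.
Theorems only (no definitions, no named facts).

We prove that the positive cone `posCone n K ⊆ hermSpace n K` of
`Literature/NumberTheory/Automorphic/ResGLnHermitianCone.lean` (self-adjoint `n × n` matrices over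
`K_∞ = ℝ^{r₁} × ℂ^{r₂}` which are positive definite at every real and every complex place) is an
OPEN subset of the real normed space `hermSpace n K` (`isOpen_posCone`), the remaining point-set
input for the model `posCone n K ≅ GL_n(K_∞)/K_∞` of the symmetric space of `Res_{K/ℚ} GL_n` as an
open convex cone [cite: Borel1969, §12].

The proof is place-wise.  For `𝕜 = ℝ` or `ℂ` (any `RCLike` field) and a finite index type `m`, the
set of matrices `A ∈ M_m(𝕜)` whose hermitian form has positive real part `re (x⋆ A x) > 0` on all
`x ≠ 0` is open (`isOpen_setOf_re_star_dotProduct_mulVec_pos`): by compactness of the unit sphere of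
`𝕜^m` and joint continuity of `(A, x) ↦ re (x⋆ A x)`, positivity on the sphere persists near a given
`A₀` (generalised tube lemma), and positivity on the sphere is positivity on all `x ≠ 0` by
homogeneity.  A HERMITIAN matrix is positive definite iff it lies in this open set
(`posDef_iff_isHermitian_and_re_pos`), the evaluation `hermSpace n K → M_n(K_w)` at a place `w` is
continuous with hermitian values, and `posCone n K` is the finite intersection of the preimages.

The topology on `hermSpace n K` elaborated in these statements is the one induced from the ambient
matrix space `M_n(K_∞)` (product topology); it is definitionally (`rfl`) the topology of the normed
space `hermSpace n K` (elementwise sup norm) of `ResGLnHermitianCone.lean`, so `isOpen_posCone`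
applies verbatim to either.  Transitivity of the `GL_n(K_∞)`-action on the cone is not treated here.

## References

* A. Borel, *Introduction aux groupes arithmétiques*, Hermann 1969, §12. [Borel1969]
-/

noncomputable section

open scoped ComplexOrder Matrix Topology
open Set Filter

namespace Literature.NumberTheory.Automorphic

namespace ResGLnCone

/-! ### Matrices over `ℝ` or `ℂ` with positive hermitian form: an open set -/

section RCLike

variable {𝕜 : Type*} [RCLike 𝕜] {m : Type*} [Fintype m]

/-- Homogeneity of the real part of the hermitian form `x ↦ re (x⋆ A x)`:
`re ((c x)⋆ A (c x)) = |c|² re (x⋆ A x)`. [folklore] -/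
theorem re_star_dotProduct_mulVec_smul (A : Matrix m m 𝕜) (c : 𝕜) (x : m → 𝕜) :
    RCLike.re (star (c • x) ⬝ᵥ (A *ᵥ (c • x))) = ‖c‖ ^ 2 * RCLike.re (star x ⬝ᵥ (A *ᵥ x)) := by
  rw [star_smul, Matrix.mulVec_smul, smul_dotProduct, dotProduct_smul, smul_smul,
    smul_eq_mul, ← starRingEnd_apply, RCLike.conj_mul, ← RCLike.ofReal_pow, RCLike.re_ofReal_mul]

/-- Joint continuity of `(A, x) ↦ re (x⋆ A x)` on `M_m(𝕜) × 𝕜^m`. [folklore] -/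
theorem continuous_re_star_dotProduct_mulVec :
    Continuous fun p : Matrix m m 𝕜 × (m → 𝕜) => RCLike.re (star p.2 ⬝ᵥ (p.1 *ᵥ p.2)) :=
  RCLike.continuous_re.comp
    ((continuous_star.comp continuous_snd).dotProduct (continuous_fst.matrix_mulVec continuous_snd))

/-- **Openness of positivity of the hermitian form.**  The set of `A ∈ M_m(𝕜)` (`𝕜 = ℝ` or `ℂ`)
with `re (x⋆ A x) > 0` for all `x ≠ 0` is open: positivity on the compact unit sphere persists
near `A₀` (generalised tube lemma) and extends to all `x ≠ 0` by homogeneity. [folklore] -/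
theorem isOpen_setOf_re_star_dotProduct_mulVec_pos :
    IsOpen {A : Matrix m m 𝕜 | ∀ x : m → 𝕜, x ≠ 0 → 0 < RCLike.re (star x ⬝ᵥ (A *ᵥ x))} := by
  rw [isOpen_iff_mem_nhds]
  intro A₀ hA₀
  have h1 : ∀ᶠ A in 𝓝 A₀, ∀ y ∈ Metric.sphere (0 : m → 𝕜) 1,
      0 < RCLike.re (star y ⬝ᵥ (A *ᵥ y)) := by
    refine (isCompact_sphere (0 : m → 𝕜) 1).eventually_forall_of_forall_eventually
      (P := fun A y => 0 < RCLike.re (star y ⬝ᵥ (A *ᵥ y))) fun y hy => ?_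
    have hy0 : y ≠ 0 := ne_zero_of_mem_unit_sphere ⟨y, hy⟩
    exact (isOpen_lt continuous_const continuous_re_star_dotProduct_mulVec).mem_nhds (hA₀ y hy0)
  refine h1.mono fun A hA x hx => ?_
  have h2 := hA ((‖x‖⁻¹ : 𝕜) • x) (by rw [mem_sphere_zero_iff_norm, norm_smul_inv_norm hx])
  rw [re_star_dotProduct_mulVec_smul] at h2
  exact pos_of_mul_pos_right h2 (sq_nonneg _)

/-- For `𝕜 = ℝ` or `ℂ`: a matrix is positive definite iff it is hermitian and `re (x⋆ A x) > 0` for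
all `x ≠ 0` (for hermitian `A` the form `x⋆ A x` is real). [folklore] -/
theorem posDef_iff_isHermitian_and_re_pos (A : Matrix m m 𝕜) :
    A.PosDef ↔ A.IsHermitian ∧ ∀ x : m → 𝕜, x ≠ 0 → 0 < RCLike.re (star x ⬝ᵥ (A *ᵥ x)) := by
  rw [Matrix.posDef_iff_dotProduct_mulVec]
  refine and_congr_right fun hA => forall_congr' fun x => imp_congr_right fun _ => ?_
  rw [RCLike.pos_iff, and_iff_left (hA.im_star_dotProduct_mulVec_self x)]

/-- The hermitian matrices with `re (x⋆ A x) > 0` for all `x ≠ 0` are exactly the positive definite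
ones; so on any family of HERMITIAN matrices depending continuously on a parameter, positive
definiteness is an open condition. [folklore] -/
theorem isOpen_setOf_posDef_comp {X : Type*} [TopologicalSpace X] {F : X → Matrix m m 𝕜}
    (hF : Continuous F) (hH : ∀ t, (F t).IsHermitian) : IsOpen {t : X | (F t).PosDef} := by
  have h : {t : X | (F t).PosDef} =
      F ⁻¹' {A : Matrix m m 𝕜 | ∀ x : m → 𝕜, x ≠ 0 → 0 < RCLike.re (star x ⬝ᵥ (A *ᵥ x))} := by
    ext t
    simp only [mem_setOf_eq, mem_preimage, posDef_iff_isHermitian_and_re_pos, and_iff_right (hH t)]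
  rw [h]
  exact isOpen_setOf_re_star_dotProduct_mulVec_pos.preimage hF

end RCLike

/-! ### The positive cone is open -/

open scoped Matrix.Norms.Elementwise Classical
open NumberField NumberField.mixedEmbedding

variable (n : ℕ) (K : Type) [Field K]

/-- Evaluation of a self-adjoint matrix over `K_∞` at a real place is continuous on `hermSpace n K`.
[folklore] -/
theorem continuous_map_mixedSpaceEvalReal (w : {w : InfinitePlace K // w.IsReal}) :
    Continuous fun H : hermSpace n K =>
      (H : Matrix (Fin n) (Fin n) (mixedSpace K)).map (mixedSpaceEvalReal K w) := by
  have hw : Continuous (mixedSpaceEvalReal K w) := (continuous_apply w).comp continuous_fst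
  exact continuous_subtype_val.matrix_map hw

/-- Evaluation of a self-adjoint matrix over `K_∞` at a complex place is continuous on
`hermSpace n K`. [folklore] -/
theorem continuous_map_mixedSpaceEvalComplex (w : {w : InfinitePlace K // w.IsComplex}) :
    Continuous fun H : hermSpace n K =>
      (H : Matrix (Fin n) (Fin n) (mixedSpace K)).map (mixedSpaceEvalComplex K w) := by
  have hw : Continuous (mixedSpaceEvalComplex K w) := (continuous_apply w).comp continuous_snd
  exact continuous_subtype_val.matrix_map hw

/-- The evaluation of `H ∈ hermSpace n K` at a real place is a symmetric (= hermitian) real matrix.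
[folklore] -/
theorem isHermitian_map_mixedSpaceEvalReal (H : hermSpace n K)
    (w : {w : InfinitePlace K // w.IsReal}) :
    ((H : Matrix (Fin n) (Fin n) (mixedSpace K)).map (mixedSpaceEvalReal K w)).IsHermitian := by
  change (_)ᴴ = _
  rw [← Matrix.conjTranspose_map (mixedSpaceEvalReal K w) (fun _ => rfl), H.2]

/-- The evaluation of `H ∈ hermSpace n K` at a complex place is a hermitian complex matrix.
[folklore] -/
theorem isHermitian_map_mixedSpaceEvalComplex (H : hermSpace n K)
    (w : {w : InfinitePlace K // w.IsComplex}) :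
    ((H : Matrix (Fin n) (Fin n) (mixedSpace K)).map (mixedSpaceEvalComplex K w)).IsHermitian := by
  change (_)ᴴ = _
  rw [← Matrix.conjTranspose_map (mixedSpaceEvalComplex K w) (fun _ => rfl), H.2]

/-- Positive definiteness at a fixed real place is an open condition on `hermSpace n K`.
[cite: Borel1969, §12] -/
theorem isOpen_setOf_posDef_mixedSpaceEvalReal (w : {w : InfinitePlace K // w.IsReal}) :
    IsOpen {H : hermSpace n K |
      ((H : Matrix (Fin n) (Fin n) (mixedSpace K)).map (mixedSpaceEvalReal K w)).PosDef} :=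
  isOpen_setOf_posDef_comp (continuous_map_mixedSpaceEvalReal n K w)
    (fun H => isHermitian_map_mixedSpaceEvalReal n K H w)

/-- Positive definiteness at a fixed complex place is an open condition on `hermSpace n K`.
[cite: Borel1969, §12] -/
theorem isOpen_setOf_posDef_mixedSpaceEvalComplex (w : {w : InfinitePlace K // w.IsComplex}) :
    IsOpen {H : hermSpace n K |
      ((H : Matrix (Fin n) (Fin n) (mixedSpace K)).map (mixedSpaceEvalComplex K w)).PosDef} :=
  isOpen_setOf_posDef_comp (continuous_map_mixedSpaceEvalComplex n K w)
    (fun H => isHermitian_map_mixedSpaceEvalComplex n K H w)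

/-- **The positive cone is open** in the hermitian space: `posCone n K` is the finite intersection,
over the real and the complex places `w` of `K`, of the open sets of `H ∈ hermSpace n K` which are
positive definite at `w` (the topology is that of the normed space `hermSpace n K`, definitionally the
one induced from `M_n(K_∞)`). [cite: Borel1969, §12] -/
theorem isOpen_posCone (n : ℕ) (K : Type) [Field K] [NumberField K] : IsOpen (posCone n K) := by
  have h : posCone n K =
      (⋂ w, {H : hermSpace n K |
        ((H : Matrix (Fin n) (Fin n) (mixedSpace K)).map (mixedSpaceEvalReal K w)).PosDef}) ∩
      ⋂ w, {H : hermSpace n K |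
        ((H : Matrix (Fin n) (Fin n) (mixedSpace K)).map (mixedSpaceEvalComplex K w)).PosDef} := by
    ext H
    simp only [mem_posCone_iff, mem_inter_iff, mem_iInter, mem_setOf_eq]
  rw [h]
  exact (isOpen_iInter_of_finite fun w => isOpen_setOf_posDef_mixedSpaceEvalReal n K w).inter
    (isOpen_iInter_of_finite fun w => isOpen_setOf_posDef_mixedSpaceEvalComplex n K w)

end ResGLnCone

end Literature.NumberTheory.Automorphic
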